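import Mathlib
import Summits.KontsevichZagierPeriods.KontsevichZagierPeriods.Theorems.SoloInformedEffectiveModel
import Summits.KontsevichZagierPeriods.KontsevichZagierPeriods.Theorems.SoloInformedDiagonalCancellation
import HarnessLib
import HarnessLib.Audit

/-!
# SoloInformed — Proposition VI (iii) completed: `P̃(F)` IS the localisation
# `P̃(C^eff) → P̃(C^eff)[per⁻¹] = P̃(C)`, and the dense contrast

Continuation of `SoloInformedEffectiveModel.lean` (Proposition VI of the SoloInformed paper,
§6quinquies).  There `F = wt_* : C^eff = 𝒞_E → C = 𝒞_ℤ` was shown faithful, not full, with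
`P̃(F)(per)` a unit and `ker P̃(F) = ℚ·(p_𝟙 − p_U) = ann(per)`.  Here:

* `isLocalization_fpMap` — `P̃(F) : P̃(C^eff) → P̃(C)` exhibits `P̃(C) = ℚ[t, t⁻¹]` as the
  LOCALISATION of the ring `P̃(C^eff)` at the powers of `per` (so the non-injective map of
  Proposition VI (iii) is literally `P̃(C^eff) → P̃(C^eff)[per⁻¹]`, as for
  `P̃(MM^eff_Nori) → P̃(MM_Nori)` in [HW22, App. A.3–A.4]): units — `per ↦ p_1`; surjectivity up
  to powers of `per` — every Laurent polynomial is `(polynomial in p_1) · p_1^{-n}` and polynomials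
  in `p_1` are `P̃(F)` of polynomials in `per` (`fpMap_aeval_per`); equalisation — by `per · ker = 0`.
* `effective_diagonalCancellation_fails` — Proposition VI as the instance `G = E`, `χ = χ¹`,
  `U + χ = χ` of Proposition VI-bis (`SoloInformedDiagonalCancellation.lean`): cancellation of `𝕃`,
  fullness of `− ⊗ 𝕃`, `per ∈ P̃(C^eff)⁰` and injectivity of `P̃(C^eff) → P̃(C^eff[𝕃⁻¹])` fail together.
* `SoloInformedGrObj.mapHomFull_iff`, `locMapFull_iff` — `h_*` is full iff `h` is injective, so
  item (4) of VI-bis is also "the localisation functor `F` is full": the diagonalizable case of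
  [HW22, Prop. 7.17].
* `fpMap_dense_injective` — the CONTRAST (the "dense" model of the paper: drop `U`): for the
  effective monoid `ℕ` (category `𝒞_ℕ = Rep(𝔸¹, ×)`, no idempotent shadow) the same localisation
  `P̃(𝒞_ℕ) = ℚ[t] → ℚ[t, t⁻¹] = P̃(𝒞_ℤ)` is injective.  The two effective models differ exactly in
  whether `{per ≠ 0}` is schematically dense in `Spec P̃(C^eff)` (`Spec ℚ[t]`: yes;
  `Spec (ℚ[t] × ℚ)`: no).

References: A. Huber, G. Wüstholz, *Transcendence and linear relations of 1-periods*, Cambridge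
Tracts in Math. 227 (2022), Def. 7.6, Prop. 7.17, App. A.3–A.4 (Def. A.9); J. Ayoub, *Nouvelles
cohomologies de Weil en caractéristique positive*, Algebra Number Theory 14 (2020), Rem. 1.3.
-/

noncomputable section

open scoped BigOperators nonZeroDivisors

namespace Summit.KontsevichZagierPeriods.KontsevichZagierPeriods.Theorems

namespace SoloInformedGrObj

variable {G G' : Type} [AddCommMonoid G] [AddCommMonoid G']

/-- FULLNESS of the change-of-degrees functor `h_* : 𝒞_G → 𝒞_{G'}`. -/
def MapHomFull (h : G →+ G') : Prop :=
  ∀ X Y : SoloInformedGrObj G, Function.Surjective (mapHom h (X := X) (Y := Y))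

/-- `h_*` is full iff `h` is injective (a graded matrix for `h ∘ deg` is graded for `deg` iff `h`
merges no two degrees; the `1 × 1` identity matrix `𝕃_a → 𝕃_b` tests it). -/
theorem mapHomFull_iff (h : G →+ G') : MapHomFull h ↔ Function.Injective h := by
  constructor
  · intro hfull a b hab
    let g : Hom (mapObj h (line a)) (mapObj h (line b)) :=
      { mat := fun _ _ => 1
        graded := fun _ _ hne => (hne hab.symm).elim }
    obtain ⟨f, hf⟩ := hfull (line a) (line b) g
    have h1 : f.mat () () = 1 := by
      have := congrArg (fun k => k.mat () ()) hf
      simpa using this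
    by_contra hne
    exact one_ne_zero (h1.symm.trans (f.graded () () fun e => hne (Eq.symm e)))
  · intro hinj X Y g
    exact ⟨{ mat := g.mat, graded := fun y x hne => g.graded y x fun e => hne (hinj e) },
      Hom.ext' rfl⟩

/-- Item (4) of Proposition VI-bis ⟺ fullness of the localisation functor
`F = (locMap χ)_* : C^eff = 𝒞_G → 𝒞_{G[−χ]} = C^eff[𝕃⁻¹]` itself — the diagonalizable case of
[HW22, Prop. 7.17] (`P̃(C′) → P̃(C)` injective ⟺ `F` full with subquotient-closed image). -/
theorem locMapFull_iff (χ : G) :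
    MapHomFull (locMap χ) ↔ Function.Injective (fpMap (locMap χ)) :=
  ((mapHomFull_iff _).trans (locMap_injective_iff χ)).trans (fpMap_locMap_injective_iff χ).symm

end SoloInformedGrObj

namespace SoloInformedEffModel

open SoloInformedGrObj SoloInformedEffIdx AddMonoidAlgebra Polynomial

/-- `P̃(F)` as a `ℚ`-algebra homomorphism. -/
def fpMapAlg : FP E →ₐ[ℚ] FP ℤ := (fpMap (G := E) wt).toRatAlgHom

/-- `fpMapAlg = fpMap wt` on elements. -/
@[simp] theorem fpMapAlg_apply (y : FP E) : fpMapAlg y = fpMap wt y := rfl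

/-- `P̃(C)` as a `P̃(C^eff)`-algebra through `P̃(F)`. -/
instance instAlgebraFP : Algebra (FP E) (FP ℤ) := (fpMap (G := E) wt).toAlgebra

/-- The structure map is `P̃(F)`. -/
theorem algebraMap_apply (y : FP E) : algebraMap (FP E) (FP ℤ) y = fpMap wt y := rfl

/-- The inverse period isomorphism `ℚ[t, t⁻¹] = ℚ[ℤ] → P̃(C)` as a `ℚ`-algebra map. -/
def symmAlg : LaurentPolynomial ℚ →ₐ[ℚ] FP ℤ :=
  (fpRingEquiv (G := ℤ)).symm.toRingHom.toRatAlgHom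

/-- `symmAlg = fpEquiv⁻¹` on elements. -/
@[simp] theorem symmAlg_apply (a : LaurentPolynomial ℚ) : symmAlg a = fpEquiv.symm a := rfl

/-- `fpEquiv⁻¹ (Tⁿ) = p_n`. -/
theorem fpEquiv_symm_T (n : ℤ) :
    fpEquiv.symm (LaurentPolynomial.T n : LaurentPolynomial ℚ) = gen n := by
  show fpEquiv.symm (AddMonoidAlgebra.single n (1 : ℚ)) = gen n
  rw [fpEquiv_symm_single, one_smul]

/-- Polynomials: `fpEquiv⁻¹ (p(T)) = p(p_1)`. -/
theorem fpEquiv_symm_toLaurent (p : ℚ[X]) :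
    fpEquiv.symm (Polynomial.toLaurent p) = Polynomial.aeval (gen (1 : ℤ)) p := by
  have key : symmAlg.comp (Polynomial.toLaurentAlg (R := ℚ)) = Polynomial.aeval (gen (1 : ℤ)) := by
    apply Polynomial.algHom_ext
    rw [AlgHom.comp_apply, Polynomial.toLaurentAlg_apply, Polynomial.toLaurent_X, symmAlg_apply,
      fpEquiv_symm_T, Polynomial.aeval_X]
  rw [← symmAlg_apply, ← Polynomial.toLaurentAlg_apply, ← AlgHom.comp_apply, key]

/-- `P̃(F)` of a polynomial in `per` is the same polynomial in `p_1`. -/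
theorem fpMap_aeval_per (p : ℚ[X]) :
    fpMap wt (Polynomial.aeval per p) = Polynomial.aeval (gen (1 : ℤ)) p := by
  rw [← fpMapAlg_apply, ← Polynomial.aeval_algHom_apply, fpMapAlg_apply, fpMap_per]

/-- `P̃(F)(perⁿ) = p_n`. -/
theorem fpMap_per_pow (n : ℕ) : fpMap wt (per ^ n) = gen (n : ℤ) := by
  rw [map_pow, fpMap_per, ← gen_nsmul, nsmul_eq_mul, mul_one]

/-- Surjectivity up to powers of `per`: every formal period of `C` is `P̃(F)(y) · P̃(F)(per)^{-n}`. -/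
theorem fpMap_surj (z : FP ℤ) : ∃ (y : FP E) (n : ℕ), z * fpMap wt (per ^ n) = fpMap wt y := by
  obtain ⟨a, rfl⟩ : ∃ a : LaurentPolynomial ℚ, z = fpEquiv.symm a := ⟨fpEquiv z, by simp⟩
  induction a using LaurentPolynomial.induction_on_mul_T with
  | _ p n =>
    refine ⟨Polynomial.aeval per p, n, ?_⟩
    rw [fpMap_aeval_per, fpMap_per_pow, ← fpEquiv_symm_toLaurent, ← fpEquiv_symm_T,
      ← fpRingEquiv_symm_apply, ← fpRingEquiv_symm_apply, ← fpRingEquiv_symm_apply, ← map_mul,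
      mul_assoc, ← LaurentPolynomial.T_add, neg_add_cancel, LaurentPolynomial.T_zero,
      mul_one]

/-- Equalisation: `P̃(F)(x) = P̃(F)(y)` iff `per · x = per · y`. -/
theorem fpMap_eq_iff (x y : FP E) : fpMap wt x = fpMap wt y ↔ per * x = per * y := by
  rw [← sub_eq_zero, ← map_sub, ker_fpMap, ← per_mul_eq_zero_iff, mul_sub, sub_eq_zero]

/-- **`P̃(C) = P̃(C^eff)[per⁻¹]`**: `P̃(F)` is the localisation of `P̃(C^eff)` at the powers of
`per` [HW22, App. A.3: `P̃(MM_Nori) = P̃(MM^eff_Nori)[per(𝕃)⁻¹]`, here decided together with its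
NON-injectivity]. -/
theorem isLocalization_fpMap : IsLocalization (Submonoid.powers per) (FP ℤ) where
  map_units := by
    rintro ⟨_, n, rfl⟩
    rw [algebraMap_apply, map_pow]
    exact isUnit_fpMap_per.pow n
  surj z := by
    obtain ⟨y, n, h⟩ := fpMap_surj z
    exact ⟨⟨y, ⟨per ^ n, n, rfl⟩⟩, h⟩
  exists_of_eq {x y} h := ⟨⟨per, Submonoid.mem_powers per⟩, (fpMap_eq_iff x y).1 h⟩

/-- `P̃(F)` is not injective although it is a localisation map: `per` is a zero divisor. -/
theorem isLocalization_not_injective :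
    IsLocalization (Submonoid.powers per) (FP ℤ) ∧
      ¬ Function.Injective (algebraMap (FP E) (FP ℤ)) :=
  ⟨isLocalization_fpMap, not_injective_fpMap⟩

/-! ### Proposition VI is an instance of Proposition VI-bis -/

/-- In `E`, `U + χ = χ` with `U ≠ 𝟙`: `χ = 𝕃` is NOT cancellable, so (Proposition VI-bis) `− ⊗ 𝕃` is
not full, `per ∉ P̃(C^eff)⁰`, and `P̃(C^eff) → P̃(C^eff[𝕃⁻¹])` (the monoid localisation `E → E[−χ]`)
is not injective — with no reference to the comparison point. -/
theorem effective_diagonalCancellation_fails :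
    ¬ IsAddRegular (chi 0 : E) ∧ ¬ TensorLineFull (chi 0 : E) ∧ per ∉ (FP E)⁰ ∧
      ¬ Function.Injective (fpMap (locMap (chi 0 : E))) :=
  diagonalCancellation_fails idem_ne_zero (idem_add_chi 0)

/-! ### The dense contrast: the effective monoid `ℕ` -/

/-- For `C^eff_0 := 𝒞_ℕ` (no idempotent `u`) the localisation `P̃(𝒞_ℕ) → P̃(𝒞_ℤ)`,
`ℚ[t] → ℚ[t, t⁻¹]`, is injective. -/
theorem fpMap_dense_injective :
    Function.Injective (fpMap (G := ℕ) (G' := ℤ) (Nat.castAddMonoidHom ℤ)) :=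
  fpMap_injective _ Nat.cast_injective

/-- … hence the Period Conjecture for `𝒞_ℤ` at `c` implies the Period Conjecture for `𝒞_ℕ` at `c`
(evaluation `p_n ↦ cⁿ`), in contrast with `not_pc_effective`. -/
theorem pc_dense_of_pc_localised {c : ℂˣ}
    (h : Function.Injective (evRingHom (G := ℤ) (AddMonoidHom.id ℤ) c)) :
    Function.Injective (evRingHom (G := ℕ) (Nat.castAddMonoidHom ℤ) c) := by
  have e : (Nat.castAddMonoidHom ℤ : ℕ →+ ℤ) = (AddMonoidHom.id ℤ).comp (Nat.castAddMonoidHom ℤ) :=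
    rfl
  intro x y hxy
  rw [e, ← ev_fpMap, ← ev_fpMap] at hxy
  exact fpMap_dense_injective (h hxy)

/-- In particular PC(`𝒞_ℕ`, `2πi`) holds while PC(`𝒞_E`, `2πi`) fails. -/
theorem pc_dense_twoPiI_and_not_pc_effective :
    Function.Injective (evRingHom (G := ℕ) (Nat.castAddMonoidHom ℤ) twoPiI) ∧
      ¬ Function.Injective (evRingHom (G := E) wt twoPiI) :=
  ⟨pc_dense_of_pc_localised pc_localised_twoPiI, not_pc_effective twoPiI⟩

end SoloInformedEffModel

end Summit.KontsevichZagierPeriods.KontsevichZagierPeriods.Theorems
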